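import Summits.ValiantsHypothesis.ValiantsHypothesis.Theorems.FreeSubtorusConfusionCoveringGradedForm
import Literature.Computability.AlgebraicComplexity.DetReprEquivalent

/-!
# `OrbitDimensionBound` (stmt-ValiantsHypothesis-16133), rung line `sign_covering` — stub `stub_perSummand`,
# preliminaries A: the graded SQUARE form of a polynomial matrix under one endomorphism pair

Tool file (first of the series `…StubPerSummand*`) for the proof of stub 1 `stub_perSummand` of the line
`Cruxes/OrbitDimensionBound/Lines/sign_covering.lean` (route `FreeSubtorus`, rung `Torsion.SignShadow`): the passage
to the per-carrying indecomposable Kronecker summand of an equivariant determinantal representation (Fitting's lemma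
and the Krull–Schmidt exchange for square matrix pencils — the step (B2) recorded, and bypassed, in
`Literature/…/LandsbergRessayreNormalForm.lean`).

Main result `exists_gradedSquareForm`.  Let `M` be an `m × m` matrix over `MvPolynomial σ ℂ` with `det M ≠ 0` and let
`(g, h) ∈ M_m(ℂ)²` be an ENDOMORPHISM PAIR of `M`, i.e. `g · M = M · h`.  Then there are `P, Q ∈ GL_m(ℂ)` and ONE weight
function `β : [m] → ℂ` (generalised eigenvalues of `g` on rows AND of `h` on columns) such that `P M Q` is `β`-GRADED:
its `(i, j)` entry vanishes unless `β i = β j`; the multiplicity of every weight `μ` is `dim E_g(μ) = dim E_h(μ)`; and if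
`g` (resp. `h`) is semisimple then `P g P⁻¹ = diag β` (resp. `Q⁻¹ h Q = diag β`).  Consequently `P M Q` is block
DIAGONAL with square blocks for every partition of the weights (`Matrix.twoBlockTriangular_det` applies).

Proof: bases adapted to the generalised eigenspaces (`FreeSubtorusConfusionCovering.exists_adapted_basis`,
`adapted_entry_eq_zero`, applied to EVERY coefficient matrix `M_d`, which all intertwine `g`, `h`); the row and column
multiplicities agree because otherwise every permutation term of `det (P M Q)` has a zero factor (pigeonhole,
`det_eq_zero_of_card_filter_ne`); re-indexing the column basis along a weight-preserving permutation
(`Equiv.ofFiberEquiv`) makes the two weight functions EQUAL.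

Helper mode (`--supports stmt-ValiantsHypothesis-16133 --as helper`).  Honest framing: [folklore] linear algebra
towards ONE registered stub of a dormant rung line; `OrbitDimensionBound`, `FreeSubtorus` and VP ≠ VNP are OPEN and
not moved by this file.

## References
* [LandsbergRessayre2017] J. M. Landsberg, N. Ressayre, *Permanent v. determinant: an exponential lower bound
  assuming symmetry*, Differential Geom. Appl. 55 (2017), §3.3–§6 (reduction to normal forms by lifts).
* N. Jacobson, *Basic Algebra II*, 2nd ed. (1989), §3.4 (Fitting's lemma, Krull–Schmidt) — orientation only.
-/

set_option linter.dupNamespace false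

namespace Summit.ValiantsHypothesis.ValiantsHypothesis.Theorems.FreeSubtorusOrbitDimensionBound.SignCovering.PerSummand

open Matrix MvPolynomial Finset Module.End
open Literature.Computability.AlgebraicComplexity
open Summit.ValiantsHypothesis.ValiantsHypothesis.Theorems.FreeSubtorusConfusionCovering

/-! ### §1 Coefficient matrices under constant base change -/

section Coeff

variable {R : Type*} [CommSemiring R] {σ ι κ θ : Type*}

/-- `coeff_d (X · M) = X · coeff_d M` for a constant matrix `X`. [folklore] -/
theorem map_coeff_map_C_mul [Fintype κ] (X : Matrix ι κ R) (M : Matrix κ θ (MvPolynomial σ R))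
    (d : σ →₀ ℕ) : (X.map (C (σ := σ)) * M).map (coeff d) = X * M.map (coeff d) := by
  ext i j
  simp only [Matrix.map_apply, Matrix.mul_apply, coeff_sum, coeff_C_mul]

/-- `coeff_d (M · Y) = coeff_d M · Y` for a constant matrix `Y`. [folklore] -/
theorem map_coeff_mul_map_C [Fintype κ] (M : Matrix ι κ (MvPolynomial σ R)) (Y : Matrix κ θ R)
    (d : σ →₀ ℕ) : (M * Y.map (C (σ := σ))).map (coeff d) = M.map (coeff d) * Y := by
  ext i j
  simp only [Matrix.map_apply, Matrix.mul_apply, coeff_sum]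
  refine Finset.sum_congr rfl fun x _ => ?_
  rw [mul_comm, coeff_C_mul, mul_comm]

/-- An entry of a polynomial matrix vanishes when all its coefficient matrices vanish there. [folklore] -/
theorem apply_eq_zero_of_forall_map_coeff (M : Matrix ι θ (MvPolynomial σ R)) (i : ι) (j : θ)
    (h : ∀ d, M.map (coeff d) i j = 0) : M i j = 0 :=
  MvPolynomial.ext _ _ fun d => by simpa only [Matrix.map_apply, coeff_zero] using h d

/-- An endomorphism pair `g M = M h` of a polynomial matrix intertwines every coefficient matrix. [folklore] -/
theorem mul_map_coeff_eq_of_map_C_mul_eq [Fintype ι] (M : Matrix ι ι (MvPolynomial σ R))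
    (g h : Matrix ι ι R) (hgh : g.map C * M = M * h.map C) (d : σ →₀ ℕ) :
    g * M.map (coeff d) = M.map (coeff d) * h := by
  rw [← map_coeff_map_C_mul, hgh, map_coeff_mul_map_C]

end Coeff

/-! ### §2 Pigeonhole: bipartite-graded square matrices with unequal multiplicities are singular -/

section Pigeonhole

variable {R : Type*} [CommRing R] {n W : Type*} [Fintype n] [DecidableEq n] [DecidableEq W]

/-- If `M i j = 0` unless `β i = α j` and some weight `μ` has different multiplicity in `β` and in `α`, then every
permutation term of `det M` has a zero factor, so `det M = 0`. [folklore] -/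
theorem det_eq_zero_of_card_filter_ne (M : Matrix n n R) (β α : n → W)
    (hM : ∀ i j, β i ≠ α j → M i j = 0) (μ : W)
    (hne : (univ.filter fun i => β i = μ).card ≠ (univ.filter fun j => α j = μ).card) :
    M.det = 0 := by
  classical
  rw [Matrix.det_apply']
  refine Finset.sum_eq_zero fun τ _ => ?_
  suffices h : ∏ i, M (τ i) i = 0 by rw [h, mul_zero]
  by_contra hprod
  apply hne
  have hall : ∀ i, β (τ i) = α i := fun i => by
    by_contra hi
    exact hprod (Finset.prod_eq_zero (Finset.mem_univ i) (hM _ _ hi))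
  have hset : (univ.filter fun j => α j = μ) = (univ.filter fun i => β i = μ).map τ.symm.toEmbedding := by
    ext j
    simp only [mem_filter, mem_univ, true_and, mem_map_equiv, Equiv.symm_symm, hall j]
  rw [hset, card_map]

end Pigeonhole

/-! ### §3 Aligning two weight functions with equal multiplicities -/

section Align

variable {n W : Type*} [Fintype n] [DecidableEq W]

/-- Two weight functions on a finite type with the same multiplicities differ by a permutation. [folklore] -/
theorem exists_perm_comp_eq (β α : n → W)
    (h : ∀ μ, (univ.filter fun i => β i = μ).card = (univ.filter fun j => α j = μ).card) :
    ∃ π : Equiv.Perm n, ∀ j, α (π j) = β j := by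
  classical
  have e : ∀ μ : W, {i // β i = μ} ≃ {j // α j = μ} := fun μ =>
    Fintype.equivOfCardEq (by
      rw [Fintype.card_subtype (fun i => β i = μ), Fintype.card_subtype (fun j => α j = μ)]; exact h μ)
  exact ⟨Equiv.ofFiberEquiv e, fun j => Equiv.ofFiberEquiv_map e j⟩

end Align

/-! ### §4 Base change to an eigenbasis diagonalises -/

section Diag

/-- In a basis `b` of eigenvectors (`g bⱼ = βⱼ bⱼ`) the matrix `g` becomes `diag β`:
`(b.toMatrix std) · g · (std.toMatrix b) = diag β`. [folklore] -/
theorem toMatrix_mul_mul_toMatrix_eq_diagonal {m : ℕ} (b : Module.Basis (Fin m) ℂ (Fin m → ℂ))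
    (g : Matrix (Fin m) (Fin m) ℂ) (β : Fin m → ℂ) (hb : ∀ j, Matrix.toLin' g (b j) = β j • b j) :
    b.toMatrix (Pi.basisFun ℂ (Fin m)) * g * (Pi.basisFun ℂ (Fin m)).toMatrix b = Matrix.diagonal β := by
  ext i j
  rw [toMatrix_mul_mul_toMatrix_apply, hb, map_smul, b.repr_self, Matrix.diagonal_apply,
    Finsupp.smul_apply, Finsupp.single_apply, smul_eq_mul]
  by_cases hij : i = j
  · subst hij; simp
  · rw [if_neg (Ne.symm hij), if_neg hij, mul_zero]

end Diag

/-! ### §5 The graded square form -/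

section Graded

variable {σ : Type*}

/-- **Graded square form of a polynomial matrix under one endomorphism pair.**  Let `M ∈ M_m(ℂ[x_σ])` with
`det M ≠ 0` and let `g, h ∈ M_m(ℂ)` satisfy `g M = M h`.  Then there are `P, Q ∈ GL_m(ℂ)` and weights `β : [m] → ℂ`
such that (1) `(P M Q) i j = 0` unless `β i = β j`; (2) `#{i | β i = μ} = dim E_g(μ)` and (3) `= dim E_h(μ)` for every
`μ` (generalised eigenspaces of `g`, `h` acting on `ℂ^m` by `Matrix.toLin'`); (4) if `g` is semisimple (every
generalised eigenvector is an eigenvector) then `P g P⁻¹ = diag β`, and (5) likewise `Q⁻¹ h Q = diag β` for `h`.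
(Bases adapted to the generalised eigenspaces of `g` on rows and of `h` on columns, the column basis re-indexed by a
weight-preserving permutation, which exists by the pigeonhole `det_eq_zero_of_card_filter_ne` since `det M ≠ 0`.)
[folklore] -/
theorem exists_gradedSquareForm {m : ℕ} (M : Matrix (Fin m) (Fin m) (MvPolynomial σ ℂ)) (hM : M.det ≠ 0)
    (g h : Matrix (Fin m) (Fin m) ℂ) (hgh : g.map C * M = M * h.map C) :
    ∃ (P Q : GL (Fin m) ℂ) (β : Fin m → ℂ),
      (∀ i j, β i ≠ β j →
        ((P : Matrix (Fin m) (Fin m) ℂ).map C * M * (Q : Matrix (Fin m) (Fin m) ℂ).map C :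
          Matrix (Fin m) (Fin m) (MvPolynomial σ ℂ)) i j = 0) ∧
      (∀ μ, (univ.filter fun i => β i = μ).card =
        Module.finrank ℂ (Module.End.maxGenEigenspace (Matrix.toLin' g) μ)) ∧
      (∀ μ, (univ.filter fun i => β i = μ).card =
        Module.finrank ℂ (Module.End.maxGenEigenspace (Matrix.toLin' h) μ)) ∧
      ((∀ (μ : ℂ) (x : Fin m → ℂ), x ∈ Module.End.maxGenEigenspace (Matrix.toLin' g) μ →
          Matrix.toLin' g x = μ • x) →
        (P : Matrix (Fin m) (Fin m) ℂ) * g * ((P⁻¹ : GL (Fin m) ℂ) : Matrix (Fin m) (Fin m) ℂ) =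
          Matrix.diagonal β) ∧
      ((∀ (μ : ℂ) (x : Fin m → ℂ), x ∈ Module.End.maxGenEigenspace (Matrix.toLin' h) μ →
          Matrix.toLin' h x = μ • x) →
        ((Q⁻¹ : GL (Fin m) ℂ) : Matrix (Fin m) (Fin m) ℂ) * h * (Q : Matrix (Fin m) (Fin m) ℂ) =
          Matrix.diagonal β) := by
  classical
  obtain ⟨bR, β, hbRmem, hbR, hβ⟩ := exists_adapted_basis m (Matrix.toLin' g)
  obtain ⟨bC, α, hbCmem, hbC, hα⟩ := exists_adapted_basis m (Matrix.toLin' h)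
  set std := Pi.basisFun ℂ (Fin m) with hstd
  -- every coefficient matrix intertwines `g` and `h`
  have hint : ∀ d : σ →₀ ℕ, g * M.map (coeff d) = (1 : ℂ) • (M.map (coeff d) * h) := fun d => by
    rw [one_smul]; exact mul_map_coeff_eq_of_map_C_mul_eq M g h hgh d
  -- vanishing in ANY pair of adapted bases
  have hvan : ∀ (bC' : Module.Basis (Fin m) ℂ (Fin m → ℂ)) (α' : Fin m → ℂ),
      (∀ j, bC' j ∈ Module.End.maxGenEigenspace (Matrix.toLin' h) (α' j)) →
      ∀ i j, β i ≠ α' j →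
        ((bR.toMatrix std).map C * M * (std.toMatrix bC').map C : Matrix (Fin m) (Fin m) (MvPolynomial σ ℂ)) i j =
          0 := by
    intro bC' α' hmem i j hne
    refine apply_eq_zero_of_forall_map_coeff _ i j fun d => ?_
    rw [map_coeff_mul_map_C, map_coeff_map_C_mul]
    exact adapted_entry_eq_zero (hint d) hmem hbR i j (by rwa [one_mul])
  -- the base-change matrices are invertible
  have hPinv : bR.toMatrix std * std.toMatrix bR = 1 := Module.Basis.toMatrix_mul_toMatrix_flip bR std
  have hPdet : (bR.toMatrix std).det ≠ 0 := by
    have h2 := congrArg Matrix.det hPinv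
    rw [Matrix.det_mul, Matrix.det_one] at h2
    exact left_ne_zero_of_mul_eq_one h2
  have hQdet' : ∀ bC' : Module.Basis (Fin m) ℂ (Fin m → ℂ), (std.toMatrix bC').det ≠ 0 := by
    intro bC'
    have h1 : std.toMatrix bC' * bC'.toMatrix std = 1 := Module.Basis.toMatrix_mul_toMatrix_flip std bC'
    have h2 := congrArg Matrix.det h1
    rw [Matrix.det_mul, Matrix.det_one] at h2
    exact left_ne_zero_of_mul_eq_one h2
  -- multiplicities of `β` and `α` agree (pigeonhole on `det (P M Q₀) ≠ 0`)
  have hcard : ∀ μ, (univ.filter fun i => β i = μ).card = (univ.filter fun j => α j = μ).card := by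
    intro μ
    by_contra hne
    have h0 := det_eq_zero_of_card_filter_ne _ β α (hvan bC α hbCmem) μ hne
    rw [det_map_C_mul_mul_map_C] at h0
    rcases mul_eq_zero.1 h0 with h1 | h1
    · exact (mul_ne_zero hPdet (hQdet' bC)) ((C_eq_zero).1 h1)
    · exact hM h1
  -- align the column weights with the row weights
  obtain ⟨π, hπ⟩ := exists_perm_comp_eq β α hcard
  set bC' : Module.Basis (Fin m) ℂ (Fin m → ℂ) := bC.reindex π.symm with hbC'
  have hbC'apply : ∀ j, bC' j = bC (π j) := fun j => by
    rw [hbC', Module.Basis.reindex_apply, Equiv.symm_symm]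
  have hbC'mem : ∀ j, bC' j ∈ Module.End.maxGenEigenspace (Matrix.toLin' h) (β j) := fun j => by
    rw [hbC'apply, ← hπ j]; exact hbCmem (π j)
  have hQinv : std.toMatrix bC' * bC'.toMatrix std = 1 := Module.Basis.toMatrix_mul_toMatrix_flip std bC'
  set P : Matrix (Fin m) (Fin m) ℂ := bR.toMatrix std with hP
  set Q : Matrix (Fin m) (Fin m) ℂ := std.toMatrix bC' with hQ
  have hQdet : Q.det ≠ 0 := hQdet' bC'
  refine ⟨Matrix.GeneralLinearGroup.mkOfDetNeZero P hPdet, Matrix.GeneralLinearGroup.mkOfDetNeZero Q hQdet, β,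
    ?_, hβ, fun μ => (hcard μ).trans (hα μ), ?_, ?_⟩
  · -- (1) graded vanishing
    intro i j hne
    rw [Matrix.GeneralLinearGroup.val_mkOfDetNeZero, Matrix.GeneralLinearGroup.val_mkOfDetNeZero]
    exact hvan bC' β hbC'mem i j hne
  · -- (4) `P g P⁻¹ = diag β` for semisimple `g`
    intro hss
    have hinv : ((Matrix.GeneralLinearGroup.mkOfDetNeZero P hPdet)⁻¹ : GL (Fin m) ℂ) =
        (std.toMatrix bR : Matrix (Fin m) (Fin m) ℂ) := by
      rw [Matrix.coe_units_inv, Matrix.GeneralLinearGroup.val_mkOfDetNeZero]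
      exact Matrix.inv_eq_right_inv hPinv
    rw [hinv, Matrix.GeneralLinearGroup.val_mkOfDetNeZero]
    exact toMatrix_mul_mul_toMatrix_eq_diagonal bR g β fun j => hss _ _ (hbRmem j)
  · -- (5) `Q⁻¹ h Q = diag β` for semisimple `h`
    intro hss
    have hinv : ((Matrix.GeneralLinearGroup.mkOfDetNeZero Q hQdet)⁻¹ : GL (Fin m) ℂ) =
        (bC'.toMatrix std : Matrix (Fin m) (Fin m) ℂ) := by
      rw [Matrix.coe_units_inv, Matrix.GeneralLinearGroup.val_mkOfDetNeZero]
      exact Matrix.inv_eq_left_inv (by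
        have := Module.Basis.toMatrix_mul_toMatrix_flip bC' std
        exact this)
    rw [hinv, Matrix.GeneralLinearGroup.val_mkOfDetNeZero]
    exact toMatrix_mul_mul_toMatrix_eq_diagonal bC' h β fun j => hss _ _ (hbC'mem j)

/-- **Block consequence.**  In the graded square form, for every weight `μ` the matrix `P M Q` is block diagonal with
respect to `{i | β i = μ}` versus its complement, so `det (P M Q)` is the product of the two diagonal blocks.
[folklore] -/
theorem det_eq_mul_of_graded {m : ℕ} {R : Type*} [CommRing R] {W : Type*}
    (A : Matrix (Fin m) (Fin m) R) (β : Fin m → W) (hA : ∀ i j, β i ≠ β j → A i j = 0)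
    (p : Fin m → Prop) [DecidablePred p] (hp : ∀ i j, p i → ¬ p j → β i ≠ β j) :
    A.det = (A.toSquareBlockProp p).det * (A.toSquareBlockProp fun i => ¬ p i).det :=
  Matrix.twoBlockTriangular_det A p fun i hi j hj => hA i j fun h => hp j i hj hi h.symm

end Graded

end Summit.ValiantsHypothesis.ValiantsHypothesis.Theorems.FreeSubtorusOrbitDimensionBound.SignCovering.PerSummand
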